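import Summits.QuantumFields.YangMills.Theorems.UnitScaleTiltProp7UntwistedChartOfBlend
import Summits.QuantumFields.YangMills.Theorems.UnitScaleTiltProp7CurvedJunctionCovariance
import Summits.QuantumFields.YangMills.Theorems.UnitScaleTiltProp7GeodesicInterp
import Literature.MathematicalPhysics.QuantumFieldTheory.Balaban1983to89.B7Eq31BCH
import HarnessLib

/-!
# Route `UnitScaleTilt`, crux K1 child «MinimiserStabilityRegPr» (stmt-QuantumFields-19200), route-R E′ path (α′), STEP 1 → 2 of the (P-knit) — R2 SMOOTHNESS BOOKKEEPING:
# THE UNTWISTED CHART SPLITS EXACTLY INTO A TRANSPORTED SMOOTH PART AND A PURE GAUGE OF THE BACKGROUND,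
# `(X^g)_b·W_b⁻¹ = Ad_{g(b₋)}(X_bW_b⁻¹) · ((W^g)_b·W_b⁻¹)`, hence `D‴ = Ad_{g₋}(A₀) + G + R₂`, `‖R₂‖ ≤ 2‖A₀‖·‖G‖`

Cell `ym3-torus` ∕ width seat `ym-ust-19200-w1` (gen 11; first-refusal row «R2 smoothness bookkeeping of `D‴`» of ★p1 g14's (P-knit) OPEN LIST, 2026-08-28 18:07Z).
THEOREMS ONLY (0 `def`, 0 `sorry`); `--supports stmt-QuantumFields-19200`, count-neutral.  YM₃ on T³ is a ladder rung (R3), not the Clay problem; nothing here claims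
the stub, the crux, d = 4 or the mass gap.

WHY (LOCATE, bus 18:2xZ).  The (P-knit) STEP 1 (✓`Prop7UntwistChartOfTwist.exists_untwistedChart_of_twist_T3`) re-gauges print's twisted representative `X = e^{iA₀}W`
(`A₀ = ηA`) by gen 9's TRILINEAR blend `g‴`; STEP 2 wants the smoothness of the chart `D‴ = (−i)log((X^{g‴})_bW_b⁻¹)`.  The trilinear blend is only C⁰ across cell faces
(`Δ log g‴ ≍ 2τℓ⁻¹` on the `3ℓ²` face sites of a cell, not `τℓ⁻²`), so `sup|D*_W D‴|` is NOT `ℓ⁻²`-small; but the kinked part is EXACTLY a pure gauge of the background: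
`(X^g)_bW_b⁻¹ = [g(b₋)·(X_bW_b⁻¹)·g(b₋)⁻¹] · [(W^g)_bW_b⁻¹]` (§1, any gauge group), i.e. `e^{iD‴_b} = Ad_{g₋}(e^{iA₀(b)}) · e^{iG_b}` with `e^{iG_b} := (W^g)_bW_b⁻¹` the chart of
`W`'s own gauge transform.  By [Balaban1985Averaging] (31): `D‴_b = g₋A₀(b)g₋* + G_b + R₂(b)`, `‖R₂(b)‖ ≤ 2‖A₀(b)‖·‖G_b‖`, `‖G_b‖ ≤ 2(3s + s′)` from `‖A₀‖ ≤ s`,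
`‖(X^g)_bW_b⁻¹ − 1‖ ≤ s′`.  So STEP 2 routes `Ad_{g₋}(A₀) + R₂` through `sup|D^*_W·|` ((1.36)₂) and `G` — a pure gauge with the twist's centre data — through the DATA form
of hInterp (its `S_H` correction replaces `g` by the covariant pinned-biharmonic extension of the same centre values); the tent blend's kinks never enter.

WHAT IS PROVED (ns `…Theorems.Prop7UntwistChartSplit`).  §1 `gaugeAct_mul_inv_eq_conj_mul` (group identity); §2 `mlog_exp_of_norm_le` (`log e^X = X`, `‖X‖ ≤ 1∕5`),
★`norm_mlog_mul_sub_le` (`‖log(PQ) − log P − log Q‖ ≤ 2‖log P‖‖log Q‖`); §3 ★★`untwistChart_split_T3` (the split with its two bounds, for `X = emb15 W (expHermField A₀)`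
and ANY gauge transformation `g`).

HONEST SCOPE.  Algebra + (31); no smoothness theorem is proved here — the file says where smoothness must come from (the datum's (1.36)₂ for `A₀`, hInterp for the gauge data).

References: T. Bałaban, CMP 98 (1985) 17–51 [Balaban1985Averaging] ((31) p.22, (19)–(21) p.21); CMP 102 (1985) 277–309 [Balaban1985Variational] ((4) p.278, (15) p.280,
(112) p.294); CMP 99 (1985) 75–102 [Balaban1985RegularSpaces] ((1.36) p.82).
-/

noncomputable section

open scoped BigOperators Matrix.Norms.L2Operator Matrix

namespace Summit.QuantumFields.YangMills.Theorems.Prop7UntwistChartSplit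

open NormedSpace
open Literature.MathematicalPhysics.QuantumFieldTheory.Balaban1983to89
open Literature.MathematicalPhysics.QuantumFieldTheory.Balaban1983to89.T3ContinuumYM3Torus
open Literature.MathematicalPhysics.QuantumFieldTheory.Balaban1983to89.T3SectALandauChart (emb15)
open T4Continuum
open MatrixLog (mlog exp_mlog norm_mlog_le_two_mul)
open BlockAveragingEMLLinearisedBackground (pertVar pertVar_eq)
open Summit.QuantumFields.YangMills.Theorems.Prop7TPrint (expHerm expHermField coe_expHerm)
open Summit.QuantumFields.YangMills.Theorems.PerturbedPlaquette (norm_conj_SU)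
open Summit.QuantumFields.YangMills.Theorems.Prop7GeodesicInterp (norm_exp_sub_one_le_three_mul)
open Summit.QuantumFields.YangMills.Theorems.Prop7CurvedJunctionCovariance (mlog_conj_SU)

/-! ## §1 The group identity -/

section Group

variable {P : Params} {j : ℕ} {G : Type*} [GaugeGroup G]

/-- `(X^g)_b·W_b⁻¹ = [g(b₋)·(X_b·W_b⁻¹)·g(b₋)⁻¹] · [(W^g)_b·W_b⁻¹]` — the untwisted relative variable is the transported one times the pure gauge of the background.
[cite: Balaban1985Variational, (4) p.278, (15) p.280] -/
theorem gaugeAct_mul_inv_eq_conj_mul (g : GaugeTransf P j G) (X W : GaugeField P j G) (b : PBond P j) :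
    GaugeField.gaugeAct g X b * (W b)⁻¹ = (g b.src * (X b * (W b)⁻¹) * (g b.src)⁻¹) * (GaugeField.gaugeAct g W b * (W b)⁻¹) := by
  show g b.src * X b * (g b.tgt)⁻¹ * (W b)⁻¹ = (g b.src * (X b * (W b)⁻¹) * (g b.src)⁻¹) * (g b.src * W b * (g b.tgt)⁻¹ * (W b)⁻¹)
  group

end Group

/-! ## §2 Logarithm letters: `log e^X = X` for small `X`, and the logarithm of a product of two near-identity elements -/

section Log

variable {m : Type*} [Fintype m] [DecidableEq m]

/-- `log(e^X) = X` for `‖X‖ ≤ 1∕5` ((31) with `Y = 0`). [cite: Balaban1985Averaging, (31) p.22] -/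
theorem mlog_exp_of_norm_le (X : Matrix m m ℂ) (hX : ‖X‖ ≤ 1 / 5) : mlog (exp X) = X := by
  have h := B7Eq31BCH.eq31_of_sum_le (X := X) (Y := (0 : Matrix m m ℂ)) (by rw [norm_zero, add_zero]; exact hX)
  rw [norm_zero, mul_zero, exp_zero, mul_one, sub_zero] at h
  exact sub_eq_zero.mp (norm_le_zero_iff.mp h)

/-- ★ `‖log(PQ) − log P − log Q‖ ≤ 2‖log P‖·‖log Q‖` for `P, Q` within `1` of the identity with `‖log P‖ + ‖log Q‖ ≤ 1∕5`. [cite: Balaban1985Averaging, (31) p.22] -/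
theorem norm_mlog_mul_sub_le {P Q : Matrix m m ℂ} (hP : ‖P - 1‖ < 1) (hQ : ‖Q - 1‖ < 1) (h : ‖mlog P‖ + ‖mlog Q‖ ≤ 1 / 5) :
    ‖mlog (P * Q) - mlog P - mlog Q‖ ≤ 2 * ‖mlog P‖ * ‖mlog Q‖ := by
  have h1 := B7Eq31BCH.eq31_of_sum_le h
  rwa [exp_mlog hP, exp_mlog hQ] at h1

end Log

/-! ## §3 The split of the untwisted chart at the carrier -/

section T3

variable {F : T3Family} {K : ℕ}

/-- ★★ **THE UNTWISTED CHART = TRANSPORTED SMOOTH PART + PURE GAUGE OF THE BACKGROUND + (31)-REMAINDER.**  `W` any `SU(2)` field on the finest torus, `A₀` Hermitian-traceless with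
`‖A₀ b‖ ≤ s`, `X := e^{iA₀}W` (`emb15 W (expHermField A₀)`), `g` ANY gauge transformation with `‖(X^g)_bW_b⁻¹ − 1‖ ≤ s′` on every bond, `7s + 2s′ ≤ 1∕5`.  With
`D‴_b := (−i)log ↑((X^g)_bW_b⁻¹)` and `G_b := (−i)log ↑((W^g)_bW_b⁻¹)`: `‖D‴_b − (g(b₋)·A₀(b)·g(b₋)* + G_b)‖ ≤ 2‖A₀ b‖·‖G_b‖` and `‖G_b‖ ≤ 2(3s + s′)` on every bond.
[cite: Balaban1985Averaging, (31) p.22; Balaban1985Variational, (15) p.280, (112) p.294] -/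
theorem untwistChart_split_T3 (W : GaugeField (F.P K) 0 (Matrix.specialUnitaryGroup (Fin 2) ℂ)) (A₀ : PBond (F.P K) 0 → Matrix (Fin 2) (Fin 2) ℂ)
    (hA : ∀ b : PBond (F.P K) 0, (A₀ b).IsHermitian ∧ Matrix.trace (A₀ b) = 0) {s s' : ℝ} (hs : ∀ b : PBond (F.P K) 0, ‖A₀ b‖ ≤ s)
    (g : GaugeTransf (F.P K) 0 (Matrix.specialUnitaryGroup (Fin 2) ℂ))
    (hs' : ∀ b : PBond (F.P K) 0, ‖pertVar W (GaugeField.gaugeAct g (emb15 W (expHermField A₀))) b‖ ≤ s') (hw : 7 * s + 2 * s' ≤ 1 / 5) :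
    ∀ b : PBond (F.P K) 0,
      ‖(-Complex.I) • mlog (((GaugeField.gaugeAct g (emb15 W (expHermField A₀)) b * (W b)⁻¹ : Matrix.specialUnitaryGroup (Fin 2) ℂ) : Matrix (Fin 2) (Fin 2) ℂ))
          - (((g b.src : Matrix.specialUnitaryGroup (Fin 2) ℂ) : Matrix (Fin 2) (Fin 2) ℂ) * A₀ b * star ((g b.src : Matrix.specialUnitaryGroup (Fin 2) ℂ) : Matrix (Fin 2) (Fin 2) ℂ)
            + (-Complex.I) • mlog (((GaugeField.gaugeAct g W b * (W b)⁻¹ : Matrix.specialUnitaryGroup (Fin 2) ℂ) : Matrix (Fin 2) (Fin 2) ℂ)))‖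
        ≤ 2 * ‖A₀ b‖ * ‖(-Complex.I) • mlog (((GaugeField.gaugeAct g W b * (W b)⁻¹ : Matrix.specialUnitaryGroup (Fin 2) ℂ) : Matrix (Fin 2) (Fin 2) ℂ))‖ ∧
      ‖(-Complex.I) • mlog (((GaugeField.gaugeAct g W b * (W b)⁻¹ : Matrix.specialUnitaryGroup (Fin 2) ℂ) : Matrix (Fin 2) (Fin 2) ℂ))‖ ≤ 2 * (3 * s + s') := by
  intro b
  have hs0 : 0 ≤ s := (norm_nonneg _).trans (hs b)
  have hs'0 : 0 ≤ s' := (norm_nonneg _).trans (hs' b)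
  have hnI : ∀ M : Matrix (Fin 2) (Fin 2) ℂ, ‖(-Complex.I) • M‖ = ‖M‖ := fun M => by rw [norm_smul, norm_neg, Complex.norm_I, one_mul]
  -- letters
  set gm : Matrix (Fin 2) (Fin 2) ℂ := ((g b.src : Matrix.specialUnitaryGroup (Fin 2) ℂ) : Matrix (Fin 2) (Fin 2) ℂ) with hgm
  set E : Matrix (Fin 2) (Fin 2) ℂ := exp (Complex.I • A₀ b) with hE
  set Pm : Matrix (Fin 2) (Fin 2) ℂ := gm * E * star gm with hPm
  set Qm : Matrix (Fin 2) (Fin 2) ℂ := ((GaugeField.gaugeAct g W b * (W b)⁻¹ : Matrix.specialUnitaryGroup (Fin 2) ℂ) : Matrix (Fin 2) (Fin 2) ℂ) with hQm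
  set Rm : Matrix (Fin 2) (Fin 2) ℂ := ((GaugeField.gaugeAct g (emb15 W (expHermField A₀)) b * (W b)⁻¹ : Matrix.specialUnitaryGroup (Fin 2) ℂ) : Matrix (Fin 2) (Fin 2) ℂ) with hRm
  -- the chart factor `X_bW_b⁻¹ = e^{iA₀(b)}`
  have hXW : (((emb15 W (expHermField A₀)) b * (W b)⁻¹ : Matrix.specialUnitaryGroup (Fin 2) ℂ) : Matrix (Fin 2) (Fin 2) ℂ) = E := by
    show (((expHerm (A₀ b) * W b * (W b)⁻¹ : Matrix.specialUnitaryGroup (Fin 2) ℂ)) : Matrix (Fin 2) (Fin 2) ℂ) = E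
    rw [mul_inv_cancel_right, coe_expHerm (hA b)]
  -- the group identity read in matrices: `R = P · Q`
  have hRPQ : Rm = Pm * Qm := by
    rw [hRm, gaugeAct_mul_inv_eq_conj_mul g (emb15 W (expHermField A₀)) W b, Submonoid.coe_mul, Submonoid.coe_mul, Submonoid.coe_mul,
      Summit.QuantumFields.YangMills.Theorems.Prop7BlendSite.coe_inv_SU, hXW]
  -- `P` is `3s`-close to `1`, `log P = g(iA₀)g*`
  have hIA : ‖Complex.I • A₀ b‖ = ‖A₀ b‖ := by rw [norm_smul, Complex.norm_I, one_mul]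
  have hE1 : ‖E - 1‖ ≤ 3 * s := by
    have := norm_exp_sub_one_le_three_mul (Complex.I • A₀ b) (by rw [hIA]; linarith [hs b])
    rw [hIA] at this; linarith [hs b]
  have hP1 : ‖Pm - 1‖ ≤ 3 * s := by
    have hc : Pm - 1 = gm * (E - 1) * star gm := by
      have hgg : gm * star gm = 1 := Matrix.mem_unitaryGroup_iff.mp (g b.src).2.1
      rw [hPm, mul_sub, sub_mul, mul_one, hgg]
    rw [hc, norm_conj_SU]; exact hE1
  have hlogP : mlog Pm = gm * (Complex.I • A₀ b) * star gm := by
    rw [hPm, mlog_conj_SU, hE, mlog_exp_of_norm_le _ (by rw [hIA]; linarith [hs b])]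
  have hnlogP : ‖mlog Pm‖ = ‖A₀ b‖ := by rw [hlogP, norm_conj_SU, hIA]
  -- `Q` is `(3s + s′)`-close to `1`: `Q = P* R`
  have hR1 : ‖Rm - 1‖ ≤ s' := by
    have := hs' b
    rwa [pertVar] at this
  have hPu : Pm ∈ Matrix.unitaryGroup (Fin 2) ℂ := by
    have hEu : E ∈ Matrix.unitaryGroup (Fin 2) ℂ := by
      rw [← hXW]; exact (((emb15 W (expHermField A₀)) b * (W b)⁻¹ : Matrix.specialUnitaryGroup (Fin 2) ℂ)).2.1
    rw [hPm]
    exact Submonoid.mul_mem _ (Submonoid.mul_mem _ (g b.src).2.1 hEu) (Unitary.star_mem (g b.src).2.1)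
  have hQ1 : ‖Qm - 1‖ ≤ 3 * s + s' := by
    have hPP : star Pm * Pm = 1 := Matrix.mem_unitaryGroup_iff'.mp hPu
    have hQeq : Qm - 1 = star Pm * (Rm - Pm) := by rw [mul_sub, hRPQ, ← mul_assoc, hPP, one_mul]
    rw [hQeq, CStarRing.norm_mem_unitary_mul _ (Unitary.star_mem hPu)]
    calc ‖Rm - Pm‖ = ‖(Rm - 1) - (Pm - 1)‖ := by rw [sub_sub_sub_cancel_right]
      _ ≤ ‖Rm - 1‖ + ‖Pm - 1‖ := norm_sub_le _ _
      _ ≤ 3 * s + s' := by linarith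
  have hG : ‖(-Complex.I) • mlog Qm‖ ≤ 2 * (3 * s + s') := by
    rw [hnI]; exact (norm_mlog_le_two_mul (hQ1.trans (by linarith))).trans (by linarith)
  refine ⟨?_, hG⟩
  -- (31) for `R = P·Q`
  have hsum : ‖mlog Pm‖ + ‖mlog Qm‖ ≤ 1 / 5 := by
    rw [hnlogP]; have := hG; rw [hnI] at this; linarith [hs b]
  have h31 := norm_mlog_mul_sub_le (hP1.trans_lt (by linarith)) (hQ1.trans_lt (by linarith)) hsum
  rw [← hRPQ, hlogP] at h31
  have hid : (-Complex.I) • mlog Rm - (gm * A₀ b * star gm + (-Complex.I) • mlog Qm)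
      = (-Complex.I) • (mlog Rm - gm * (Complex.I • A₀ b) * star gm - mlog Qm) := by
    rw [smul_sub, smul_sub, mul_smul_comm, smul_mul_assoc, smul_smul, show (-Complex.I) * Complex.I = 1 by rw [neg_mul, Complex.I_mul_I, neg_neg], one_smul]
    abel
  rw [hid, hnI, hnI]
  calc ‖mlog Rm - gm * (Complex.I • A₀ b) * star gm - mlog Qm‖ ≤ 2 * ‖gm * (Complex.I • A₀ b) * star gm‖ * ‖mlog Qm‖ := h31
    _ = 2 * ‖A₀ b‖ * ‖mlog Qm‖ := by rw [norm_conj_SU, hIA]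

end T3

end Summit.QuantumFields.YangMills.Theorems.Prop7UntwistChartSplit

end
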